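import Summits.CriticalPhenomena.PercolationContinuityZ3.Theorems.PercNearOneGluingNoHeavyLowerTailKnQuestion8CoefficientwiseRootSetKernelSplit
import HarnessLib

/-!
# The root-set kernel: the THREE-ATOM split of RCSET — prim-lf-2 gen 60

Support file (`--supports stmt-CriticalPhenomena-4575`, closed), prover `prim-lf-2` (gen 60).  No definitions, no named facts, no sorries; standard axioms.
Memo `prim-lf-2/CW-ATOM-gen60.md` §9, §11; companions `…RootSetKernelSplit.lean` (`kernel_split_identity`: 2Φ(S,S′) − Φ(S′,S′) = GCBP + 2·REST),
`…CoefficientwiseNoCoreAtomSplit.lean` (the case `S = S′`: NC = A₀₀ + 2·A₀B).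

Setting.  Edge finset `E`, colourings `s ⊆ E` (red) / `E ∖ s` (blue); two maps `K P : Finset ι → Set V` — the red clusters of the nested root sets `S ⊆ S′` as functions of the red
edge set — so that the blue clusters are `L s = K (E ∖ s)` and `B s = P (E ∖ s)`; a target `y`; `T(X,Y) = (fX − fY)(gX − gY)` and the GCB summand
`g(s) = T(K s, B s) + T(L s, P s) − T(P s, B s)`.  The `S′`-ADMISSIBLE colourings (`¬(y ∈ P s ∧ y ∈ B s)`) split by the position of `y` into `00 = {y ∉ P s, y ∉ B s}`,
`0B = {y ∉ P s, y ∈ B s}`, `P0 = {y ∈ P s, y ∉ B s}`, and the colour swap `s ↦ E ∖ s` maps `P0` onto `0B`, `(K,P,B,L) ↦ (L,B,P,K)`.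
* `Coefficientwise.gcbp_atom_split` — IDENTITY: `GCBP := Σ_{S′-adm} [2T(K s,B s) − T(P s,B s)] = Σ_{00} g + 2·Σ_{0B} g`.
* `Coefficientwise.rcset_of_three_atoms` — `0 ≤ Σ_{00} g → 0 ≤ Σ_{0B} g → 0 ≤ REST → Φ(S′,S′) ≤ 2Φ(S,S′)` (with `kernel_split_identity`; needs `K s ⊆ P s`).
THE THREE ATOM CONJECTURES (prim-lf-2 gen 60, memo §11): for the clusters of nested root sets `S ⊆ S′` of a finite multigraph and monotone `f, g`:
(A1) `Σ_{y∉P∪B} g ≥ 0`, (A2) `Σ_{y∈B∖P} g ≥ 0`, (A3) `REST = Σ_{y∈P∩B, y∉K} T(K,B) ≥ 0`.  Exact census (all monotone pairs; every connected graph on ≤ 5 vertices, every target,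
every nested pair): 0 failures each; the individual raw classes `Σ_{0B}[2T_S − 2T_U]`, `Σ_{P0} 2T_S` are NOT of constant sign.  For `S = S′` (A1)+(A2) is CONJECTURE NO-CORE.
[cite: KozmaNitzan2024, Questions 8–9 (§5.5 p. 36) (context: the Question-8 pocket covariance programme)]
-/

namespace Summit.CriticalPhenomena.PercolationContinuityZ3.Theorems

open Finset

namespace Coefficientwise

variable {ι V : Type*}

open Classical in
/-- **Three-atom split of the admissible part (identity).**  See the module docstring: with `B s = P (E ∖ s)`, `L s = K (E ∖ s)` and
`g s = T(K s, B s) + T(L s, P s) − T(P s, B s)`,  `Σ_{s ⊆ E, ¬(y∈P s ∧ y∈B s)} [2T(K s,B s) − T(P s,B s)] = Σ_{y∉P s, y∉B s} g + 2·Σ_{y∉P s, y∈B s} g`. [folklore] -/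
theorem gcbp_atom_split [DecidableEq ι] (E : Finset ι) (K P : Finset ι → Set V) (y : V) (f g : Set V → ℝ) :
    ∑ s ∈ E.powerset.filter (fun s => ¬ (y ∈ P s ∧ y ∈ P (E \ s))),
        (2 * ((f (K s) - f (P (E \ s))) * (g (K s) - g (P (E \ s)))) - (f (P s) - f (P (E \ s))) * (g (P s) - g (P (E \ s)))) =
      (∑ s ∈ E.powerset.filter (fun s => y ∉ P s ∧ y ∉ P (E \ s)),
          ((f (K s) - f (P (E \ s))) * (g (K s) - g (P (E \ s))) + (f (K (E \ s)) - f (P s)) * (g (K (E \ s)) - g (P s)) -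
            (f (P s) - f (P (E \ s))) * (g (P s) - g (P (E \ s))))) +
        2 * ∑ s ∈ E.powerset.filter (fun s => y ∉ P s ∧ y ∈ P (E \ s)),
          ((f (K s) - f (P (E \ s))) * (g (K s) - g (P (E \ s))) + (f (K (E \ s)) - f (P s)) * (g (K (E \ s)) - g (P s)) -
            (f (P s) - f (P (E \ s))) * (g (P s) - g (P (E \ s)))) := by
  -- notation: `TS s = T(K s, B s)`, `TL s = T(L s, P s)`, `TU s = T(P s, B s)`
  set TS : Finset ι → ℝ := fun s => (f (K s) - f (P (E \ s))) * (g (K s) - g (P (E \ s))) with hTS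
  set TL : Finset ι → ℝ := fun s => (f (K (E \ s)) - f (P s)) * (g (K (E \ s)) - g (P s)) with hTL
  set TU : Finset ι → ℝ := fun s => (f (P s) - f (P (E \ s))) * (g (P s) - g (P (E \ s))) with hTU
  change ∑ s ∈ E.powerset.filter (fun s => ¬ (y ∈ P s ∧ y ∈ P (E \ s))), (2 * TS s - TU s) =
    (∑ s ∈ E.powerset.filter (fun s => y ∉ P s ∧ y ∉ P (E \ s)), (TS s + TL s - TU s)) +
      2 * ∑ s ∈ E.powerset.filter (fun s => y ∉ P s ∧ y ∈ P (E \ s)), (TS s + TL s - TU s)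
  have hss : ∀ s ∈ E.powerset, E \ (E \ s) = s := fun s hs => Finset.sdiff_sdiff_eq_self (Finset.mem_powerset.mp hs)
  -- values under the swap
  have swapTS : ∀ s ∈ E.powerset, TS (E \ s) = TL s := by intro s hs; simp only [hTS, hTL, hss s hs]
  have swapTL : ∀ s ∈ E.powerset, TL (E \ s) = TS s := by intro s hs; simp only [hTS, hTL, hss s hs]
  have swapTU : ∀ s ∈ E.powerset, TU (E \ s) = TU s := by intro s hs; simp only [hTU, hss s hs]; ring
  -- split the admissible colourings into the three atoms
  have h1 : ∀ φ : Finset ι → ℝ, ∑ s ∈ E.powerset.filter (fun s => ¬ (y ∈ P s ∧ y ∈ P (E \ s))), φ s =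
      ∑ s ∈ E.powerset.filter (fun s => y ∉ P s ∧ y ∉ P (E \ s)), φ s + ∑ s ∈ E.powerset.filter (fun s => y ∉ P s ∧ y ∈ P (E \ s)), φ s +
        ∑ s ∈ E.powerset.filter (fun s => y ∈ P s ∧ y ∉ P (E \ s)), φ s := by
    intro φ
    rw [← Finset.sum_filter_add_sum_filter_not (E.powerset.filter (fun s => ¬ (y ∈ P s ∧ y ∈ P (E \ s)))) (fun s => y ∉ P s)]
    rw [← Finset.sum_filter_add_sum_filter_not ((E.powerset.filter (fun s => ¬ (y ∈ P s ∧ y ∈ P (E \ s)))).filter (fun s => y ∉ P s)) (fun s => y ∉ P (E \ s))]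
    congr 1
    · congr 1
      · congr 1; ext s; simp only [Finset.mem_filter]; tauto
      · congr 1; ext s; simp only [Finset.mem_filter, not_not]; tauto
    · congr 1; ext s; simp only [Finset.mem_filter, not_not]; tauto
  -- the swap: a sum over `P0` equals the corresponding sum over `0B`
  have swap : ∀ φ ψ : Finset ι → ℝ, (∀ s ∈ E.powerset, φ (E \ s) = ψ s) →
      ∑ s ∈ E.powerset.filter (fun s => y ∈ P s ∧ y ∉ P (E \ s)), φ s = ∑ s ∈ E.powerset.filter (fun s => y ∉ P s ∧ y ∈ P (E \ s)), ψ s := by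
    intro φ ψ hφψ
    refine Finset.sum_bij' (fun s _ => E \ s) (fun s _ => E \ s) ?_ ?_ ?_ ?_ ?_
    · intro s hs
      obtain ⟨hsE, ha, hb⟩ := by simpa only [Finset.mem_filter] using hs
      refine Finset.mem_filter.mpr ⟨Finset.mem_powerset.mpr Finset.sdiff_subset, hb, ?_⟩
      rw [hss s hsE]; exact ha
    · intro s hs
      obtain ⟨hsE, ha, hb⟩ := by simpa only [Finset.mem_filter] using hs
      refine Finset.mem_filter.mpr ⟨Finset.mem_powerset.mpr Finset.sdiff_subset, hb, ?_⟩
      rw [hss s hsE]; exact ha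
    · intro s hs; exact hss s (Finset.mem_filter.mp hs).1
    · intro s hs; exact hss s (Finset.mem_filter.mp hs).1
    · intro s hs
      have hsE := (Finset.mem_filter.mp hs).1
      have h := hφψ (E \ s) (Finset.mem_powerset.mpr Finset.sdiff_subset)
      rw [hss s hsE] at h
      exact h
  -- apply to the pieces
  have eP0 : ∑ s ∈ E.powerset.filter (fun s => y ∈ P s ∧ y ∉ P (E \ s)), (2 * TS s - TU s) =
      ∑ s ∈ E.powerset.filter (fun s => y ∉ P s ∧ y ∈ P (E \ s)), (2 * TL s - TU s) := by
    refine swap (fun s => 2 * TS s - TU s) (fun s => 2 * TL s - TU s) fun s hs => ?_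
    simp only [swapTS s hs, swapTU s hs]
  have e00 : ∑ s ∈ E.powerset.filter (fun s => y ∉ P s ∧ y ∉ P (E \ s)), TS s = ∑ s ∈ E.powerset.filter (fun s => y ∉ P s ∧ y ∉ P (E \ s)), TL s := by
    -- the swap maps `00` to itself
    refine Finset.sum_bij' (fun s _ => E \ s) (fun s _ => E \ s) ?_ ?_ ?_ ?_ ?_
    · intro s hs
      obtain ⟨hsE, ha, hb⟩ := by simpa only [Finset.mem_filter] using hs
      refine Finset.mem_filter.mpr ⟨Finset.mem_powerset.mpr Finset.sdiff_subset, hb, ?_⟩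
      rw [hss s hsE]; exact ha
    · intro s hs
      obtain ⟨hsE, ha, hb⟩ := by simpa only [Finset.mem_filter] using hs
      refine Finset.mem_filter.mpr ⟨Finset.mem_powerset.mpr Finset.sdiff_subset, hb, ?_⟩
      rw [hss s hsE]; exact ha
    · intro s hs; exact hss s (Finset.mem_filter.mp hs).1
    · intro s hs; exact hss s (Finset.mem_filter.mp hs).1
    · intro s hs
      have hsE := (Finset.mem_filter.mp hs).1
      exact (swapTL s hsE).symm
  rw [h1, eP0]
  have a00 : ∑ s ∈ E.powerset.filter (fun s => y ∉ P s ∧ y ∉ P (E \ s)), (2 * TS s - TU s) =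
      ∑ s ∈ E.powerset.filter (fun s => y ∉ P s ∧ y ∉ P (E \ s)), (TS s + TL s - TU s) := by
    have : ∑ s ∈ E.powerset.filter (fun s => y ∉ P s ∧ y ∉ P (E \ s)), (2 * TS s - TU s) =
        ∑ s ∈ E.powerset.filter (fun s => y ∉ P s ∧ y ∉ P (E \ s)), TS s + ∑ s ∈ E.powerset.filter (fun s => y ∉ P s ∧ y ∉ P (E \ s)), (TS s - TU s) := by
      rw [← Finset.sum_add_distrib]; refine Finset.sum_congr rfl fun s _ => by ring
    rw [this, e00, ← Finset.sum_add_distrib]; refine Finset.sum_congr rfl fun s _ => by ring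
  rw [a00]
  have b0B : ∑ s ∈ E.powerset.filter (fun s => y ∉ P s ∧ y ∈ P (E \ s)), (2 * TS s - TU s) +
      ∑ s ∈ E.powerset.filter (fun s => y ∉ P s ∧ y ∈ P (E \ s)), (2 * TL s - TU s) =
      2 * ∑ s ∈ E.powerset.filter (fun s => y ∉ P s ∧ y ∈ P (E \ s)), (TS s + TL s - TU s) := by
    rw [← Finset.sum_add_distrib, Finset.mul_sum]; refine Finset.sum_congr rfl fun s _ => by ring
  linarith [b0B]

open Classical in
/-- **RCSET from the three atoms.**  For maps `K P : Finset ι → Set V` with `K s ⊆ P s` for `s ⊆ E` (red clusters of nested root sets; blue clusters `K (E∖s)`, `P (E∖s)`), a target `y`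
and reals `f, g`: if the atoms (A1) `Σ_{y∉P s, y∉P(E∖s)} g ≥ 0`, (A2) `Σ_{y∉P s, y∈P(E∖s)} g ≥ 0` (`g` as in `gcbp_atom_split`) and (A3)
`REST = Σ_{y∈P s, y∈P(E∖s), y∉K s} T(K s, P(E∖s)) ≥ 0`, then `Φ(S′,S′) ≤ 2Φ(S,S′)`, i.e.
`Σ_{¬(y∈P s∧y∈P(E∖s))} T(P s,P(E∖s)) ≤ 2·Σ_{¬(y∈K s∧y∈P(E∖s))} T(K s,P(E∖s))`. [cite: KozmaNitzan2024, Questions 8–9 (§5.5 p. 36) (context)] -/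
theorem rcset_of_three_atoms [DecidableEq ι] (E : Finset ι) (K P : Finset ι → Set V) (y : V) (hsub : ∀ s ∈ E.powerset, K s ⊆ P s) (f g : Set V → ℝ)
    (hA1 : 0 ≤ ∑ s ∈ E.powerset.filter (fun s => y ∉ P s ∧ y ∉ P (E \ s)),
        ((f (K s) - f (P (E \ s))) * (g (K s) - g (P (E \ s))) + (f (K (E \ s)) - f (P s)) * (g (K (E \ s)) - g (P s)) -
          (f (P s) - f (P (E \ s))) * (g (P s) - g (P (E \ s)))))
    (hA2 : 0 ≤ ∑ s ∈ E.powerset.filter (fun s => y ∉ P s ∧ y ∈ P (E \ s)),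
        ((f (K s) - f (P (E \ s))) * (g (K s) - g (P (E \ s))) + (f (K (E \ s)) - f (P s)) * (g (K (E \ s)) - g (P s)) -
          (f (P s) - f (P (E \ s))) * (g (P s) - g (P (E \ s)))))
    (hA3 : 0 ≤ ∑ s ∈ E.powerset.filter (fun s => (y ∈ P s ∧ y ∈ P (E \ s)) ∧ y ∉ K s), (f (K s) - f (P (E \ s))) * (g (K s) - g (P (E \ s)))) :
    ∑ s ∈ E.powerset.filter (fun s => ¬ (y ∈ P s ∧ y ∈ P (E \ s))), (f (P s) - f (P (E \ s))) * (g (P s) - g (P (E \ s))) ≤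
      2 * ∑ s ∈ E.powerset.filter (fun s => ¬ (y ∈ K s ∧ y ∈ P (E \ s))), (f (K s) - f (P (E \ s))) * (g (K s) - g (P (E \ s))) := by
  have hsplit := kernel_split_identity E.powerset K P (fun s => P (E \ s)) y hsub f g
  have hatoms := gcbp_atom_split E K P y f g
  have hadm : 0 ≤ ∑ s ∈ E.powerset.filter (fun s => ¬ (y ∈ P s ∧ y ∈ P (E \ s))),
      (2 * ((f (K s) - f (P (E \ s))) * (g (K s) - g (P (E \ s)))) - (f (P s) - f (P (E \ s))) * (g (P s) - g (P (E \ s)))) := by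
    rw [hatoms]; nlinarith [hA1, hA2]
  exact rcset_of_admPart_of_rest E.powerset K P (fun s => P (E \ s)) y hsub f g hadm hA3

end Coefficientwise

end Summit.CriticalPhenomena.PercolationContinuityZ3.Theorems
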